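import Summits.QuantumFields.YangMills.Theorems.ColdStartUniversalityColdStartSolutionsExistTangentTools
import Literature.Probability.Process.ItoIntegralConstruction
import Literature.Probability.Process.BrownianQuadraticSums
import HarnessLib

/-!
# Route `ColdStartUniversality`, support item S (stmt-QuantumFields-24811), line `piwiener`:
# stub B tools IV — dyadic-grid bookkeeping: telescoping, elementary integrals at grid points, and the
# `L²` bound for Riemann–Stieltjes sums with clamped sampled weights against a martingale

Helper file (lead `ym-line-csu-p1`) for stub B1 `stub_tangentSumSq`.  On the dyadic grid `j/2ⁿ`:

* `telescope_sq` — `a_N² − a_0² = Σ_{j<N} (2 a_j (a_{j+1} − a_j) + (a_{j+1} − a_j)²)`;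
* `sample_integral_dyadic` — the elementary integral of a dyadically sampled process `sample Z n` against
  any process `I`, evaluated at a grid point `N/2ⁿ ≤ n`, is the Riemann–Stieltjes sum
  `Σ_{j<N} clamp n (Z_{j/2ⁿ}) (I_{(j+1)/2ⁿ} − I_{j/2ⁿ})`;
* `sample_integral_dyadic_succ_sub` — its increment over one grid cell;
* `integral_sq_sample_integral_le` — **`E[((sample Z n)·M)_t²] ≤ C² E[M_t²]`** at a grid point `t`, for a
  square-integrable martingale `M` and `|Z| ≤ C` clamped weights (`simple_integral_sq_le_of_martingale`).

No definition, no sorry.  RECORD-rung plumbing; nothing here bears on the Yang–Mills mass gap. -/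

set_option autoImplicit false

noncomputable section

namespace Summit.QuantumFields.YangMills.Theorems.ColdStartUniversality

open MeasureTheory ProbabilityTheory Filter Topology Finset
open scoped NNReal ENNReal BigOperators
open Literature.Probability.Process

/-- **Telescoping the square**: `a_N² − a_0² = Σ_{j<N} (2 a_j (a_{j+1} − a_j) + (a_{j+1} − a_j)²)` (the exact
second-order Taylor expansion of `y ↦ y²` along a grid). [folklore] -/
theorem telescope_sq (a : ℕ → ℝ) (N : ℕ) :
    a N ^ 2 - a 0 ^ 2 = ∑ j ∈ range N, (2 * a j * (a (j + 1) - a j) + (a (j + 1) - a j) ^ 2) := by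
  induction N with
  | zero => simp
  | succ N ih =>
    rw [Finset.sum_range_succ, ← ih]
    ring

variable {Ω : Type*} {m : MeasurableSpace Ω} {𝓕 : Filtration ℝ≥0 m} {μ : Measure Ω}

/-- Partition times of the dyadic sampled process: `time j = j/2ⁿ` for `j ≤ n 2ⁿ`. [folklore] -/
theorem sample_time_eq {Z : ℝ≥0 → Ω → ℝ} (hZ : Adapted 𝓕 Z) (n : ℕ) {j : ℕ} (hj : j ≤ n * 2 ^ n) :
    (SimpleProcess.sample Z hZ n).time j = (j : ℝ≥0) / 2 ^ n :=
  SimpleProcess.sample_time Z hZ n (by omega)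

/-- **Elementary integral of a dyadically sampled process at a grid point**: for `N ≤ n 2ⁿ` and any
process `I`, `((sample Z n)·I)_{N/2ⁿ} = Σ_{j<N} clamp n (Z_{j/2ⁿ}) (I_{(j+1)/2ⁿ} − I_{j/2ⁿ})`. [folklore] -/
theorem sample_integral_dyadic {Z : ℝ≥0 → Ω → ℝ} (hZ : Adapted 𝓕 Z) (n : ℕ) (I : ℝ≥0 → Ω → ℝ) {N : ℕ}
    (hN : N ≤ n * 2 ^ n) (ω : Ω) :
    (SimpleProcess.sample Z hZ n).integral I ((N : ℝ≥0) / 2 ^ n) ω =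
      ∑ j ∈ range N, clamp n (Z ((j : ℝ≥0) / 2 ^ n) ω) *
        (I (((j + 1 : ℕ) : ℝ≥0) / 2 ^ n) ω - I ((j : ℝ≥0) / 2 ^ n) ω) := by
  have hlen : (SimpleProcess.sample Z hZ n).times.length = n * 2 ^ n + 1 := by
    simp [SimpleProcess.sample_times, length_dyadicTimes]
  have h2 : (0 : ℝ≥0) < 2 ^ n := pow_pos two_pos n
  rw [SimpleProcess.integral]
  simp only [hlen, Nat.add_sub_cancel]
  -- split the sum at `N`
  rw [← Finset.sum_range_add_sum_Ico _ hN]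
  have htail : ∑ i ∈ Finset.Ico N (n * 2 ^ n), (SimpleProcess.sample Z hZ n).value i ω *
      (I (min ((N : ℝ≥0) / 2 ^ n) ((SimpleProcess.sample Z hZ n).time (i + 1))) ω -
        I (min ((N : ℝ≥0) / 2 ^ n) ((SimpleProcess.sample Z hZ n).time i)) ω) = 0 := by
    refine Finset.sum_eq_zero fun i hi => ?_
    obtain ⟨hNi, hin⟩ := Finset.mem_Ico.1 hi
    rw [sample_time_eq hZ n (by omega), sample_time_eq hZ n (by omega),
      min_eq_left (div_le_div_of_nonneg_right (by exact_mod_cast (by omega : N ≤ i + 1)) h2.le),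
      min_eq_left (div_le_div_of_nonneg_right (by exact_mod_cast hNi) h2.le), sub_self, mul_zero]
  rw [htail, add_zero]
  refine Finset.sum_congr rfl fun j hj => ?_
  have hjN := Finset.mem_range.1 hj
  rw [sample_time_eq hZ n (by omega), sample_time_eq hZ n (by omega), SimpleProcess.sample_value,
    min_eq_right (div_le_div_of_nonneg_right (by exact_mod_cast (by omega : j + 1 ≤ N)) h2.le),
    min_eq_right (div_le_div_of_nonneg_right (by exact_mod_cast hjN.le) h2.le)]

/-- Increment of the elementary integral of a dyadically sampled process over one grid cell:
`((sample Z n)·I)_{(j+1)/2ⁿ} − ((sample Z n)·I)_{j/2ⁿ} = clamp n (Z_{j/2ⁿ}) (I_{(j+1)/2ⁿ} − I_{j/2ⁿ})` for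
`j + 1 ≤ n 2ⁿ`. [folklore] -/
theorem sample_integral_dyadic_succ_sub {Z : ℝ≥0 → Ω → ℝ} (hZ : Adapted 𝓕 Z) (n : ℕ) (I : ℝ≥0 → Ω → ℝ)
    {j : ℕ} (hj : j + 1 ≤ n * 2 ^ n) (ω : Ω) :
    (SimpleProcess.sample Z hZ n).integral I (((j + 1 : ℕ) : ℝ≥0) / 2 ^ n) ω -
        (SimpleProcess.sample Z hZ n).integral I ((j : ℝ≥0) / 2 ^ n) ω =
      clamp n (Z ((j : ℝ≥0) / 2 ^ n) ω) * (I (((j + 1 : ℕ) : ℝ≥0) / 2 ^ n) ω - I ((j : ℝ≥0) / 2 ^ n) ω) := by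
  rw [sample_integral_dyadic hZ n I hj, sample_integral_dyadic hZ n I (by omega : j ≤ n * 2 ^ n),
    Finset.sum_range_succ, add_sub_cancel_left]

/-- **Riemann–Stieltjes sums with clamped sampled weights against a square-integrable martingale**:
for `|Z| ≤ C`, a square-integrable martingale `M` and a grid point `t = N/2ⁿ ≤ n`,
`E[(Σ_{j<N} clamp n (Z_{j/2ⁿ}) Δ_jM)²] ≤ C² E[M_t²]`. [folklore] -/
theorem integral_sq_sample_integral_le [IsProbabilityMeasure μ] {Z : ℝ≥0 → Ω → ℝ} (hZ : Adapted 𝓕 Z)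
    {C : ℝ} (hC : ∀ s ω, |Z s ω| ≤ C) {M : ℝ≥0 → Ω → ℝ} (hM : Martingale M 𝓕 μ)
    (hM2 : ∀ t, MemLp (M t) 2 μ) (n : ℕ) {N : ℕ} (hN : N ≤ n * 2 ^ n) :
    ∫ ω, (∑ j ∈ range N, clamp n (Z ((j : ℝ≥0) / 2 ^ n) ω) *
        (M (((j + 1 : ℕ) : ℝ≥0) / 2 ^ n) ω - M ((j : ℝ≥0) / 2 ^ n) ω)) ^ 2 ∂μ ≤
      C ^ 2 * ∫ ω, M ((N : ℝ≥0) / 2 ^ n) ω ^ 2 ∂μ := by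
  have hval : ∀ i ω, |(SimpleProcess.sample Z hZ n).value i ω| ≤ C := fun i ω => by
    rw [SimpleProcess.sample_value]
    exact (abs_clamp_le_abs (Nat.cast_nonneg n) _).trans (hC _ _)
  have h := simple_integral_sq_le_of_martingale (SimpleProcess.sample Z hZ n) hM hM2 hval ((N : ℝ≥0) / 2 ^ n)
  simp_rw [sample_integral_dyadic hZ n M hN] at h
  exact h

end Summit.QuantumFields.YangMills.Theorems.ColdStartUniversality

end
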